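import Literature.NumberTheory.Rogawski1990.RankOneUnstableWildWindowSide           -- ★ p844613 B-p14 (g34): `exists_unit_toPlace_eq_of_not_exists_norm`, `exists_uniformizer_toPlace_eq_mul`; brings ★ V2 bookkeeping
import Literature.NumberTheory.Rogawski1990.RankOneKappaShellAverageDeepAnyAlpha    -- ★ p844557 B-p10 (g27) (V-deep): `exists_depth_shellAverage_eq_of_descent_congr'`
import HarnessLib

/-!
# (B6-V) «THE VALUE LAWS ON THE TORUS» — THE DEEP LAW `hdeep` from the Eisenstein coordinates
# (road «W′» = «R1LL-WILD»; Labesse–Langlands (2.2), Labesse 2024 Prop. 0.0.11)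

Topic `NumberTheory/Rogawski1990`; namespace `Literature.NumberTheory.Rogawski1990`.  THEOREMS ONLY (no definition, no instance, no notation, no named fact,
no `sorry`).  Cell `pub/hodgecm-mathlib` (D-0151), crux H413 = `stmt-HodgeConjecture-24833`, line «N6nsGerm», wild residue; (B6-V) HEAD `exists_wildValueLaws` =
F0P3a-p08 (g16); this file = B-p14 (g34)'s «cut D» (bus 13:35:57Z), sibling of ★ `RankOneUnstableWildWindowSide` ∕ ★ `…Assembly`.

THE MATHEMATICS.  For `t ∈ Z(t₀)` with Eisenstein normal form `diag(1,α) X_t diag(1,α)⁻¹ = ζ t · ι_w(1, β v₀; β, 1 + β u₀)` (`β = β t`, `|β|_v = exp(−o)`), the shell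
conjugates `r_m⁻¹ X_t r_m` (`r_m = uη^{−m}`, `uη = diag(ηE, σ̄ηE⁻¹)`) and `r_m⁻¹ X_{e t} r_m` (`X_{e t} = D_u X_t D_u⁻¹`, `u = ι u_F`) descend to `ζ t · ι S_m` and
`ζ t · ι S′_m` with `S_m = (1, β v₀ c^m; β c^{−m}, 1 + β u₀)`, `S′_m = D_{u_F} S_m D_{u_F}⁻¹ = (1, β v₀ c^m u_F⁻¹; u_F β c^{−m}, 1 + β u₀)` (`c = N(ηE)` a uniformiser
of `L⁺_v`; ★ `descent_shellConjugate`, ★ `coe_glDiagonal_pow_conj_regRep`, ★ `descent_conj_diagonal_eq`).  Both are `≡ 1 (mod 𝔭^j)` as soon as `m + j ≤ o`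
(entries `β v₀ c^m`, `β c^{−m}`, `β u₀`, unit twists), so ★ B-p10's (V-deep) head gives `F̄_m(t) = F̄_m(e t)`: the `hdeep` conjunct of the (B6-V) HEAD, here in
POINTWISE form (no depth threshold, §2) and in the HEAD's text (§2, `hdeep_of_pointwise`).
HONEST LABEL: HC_CM is proved only modulo the 2 remaining named inputs (hLiu418, h413) until rung 0 closes; this file is unconditional bookkeeping over ★ lemmas.

## References
* [LabesseLanglands1979] J.-P. Labesse, R. P. Langlands, *L-indistinguishability for SL(2)*, Canad. J. Math. 31 (1979): §2 (2.2) p. 9 (deep shells agree).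
* [Labesse2024StabilisationGermesSL2] J.-P. Labesse, *Stabilisation des germes de SL(2)* (2024): Prop. 0.0.11.
* [Rogawski1990] J. D. Rogawski, *Automorphic Representations of Unitary Groups in Three Variables*, Ann. of Math. Stud. 123 (1990): §4.9 Lemma 4.9.3 p. 56.
-/

set_option autoImplicit false

noncomputable section

open Set Filter Topology MeasureTheory NumberField IsDedekindDomain Finset Matrix ValuativeRel Function MulAction
open scoped Matrix MatrixGroups ValuativeRel WithZero

namespace Literature.NumberTheory.Rogawski1990

open Literature.NumberTheory.Automorphic Literature.NumberTheory.Automorphic.UnitaryGroup Literature.NumberTheory.GaloisRepresentations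
open Literature.NumberTheory.QuadraticForms Literature.NumberTheory.NumberFields Literature.NumberTheory.Automorphic.HermitianLatticeTree

/-! ## §1 Bookkeeping: twisted window matrices and their congruence to `1` -/

section Bookkeeping

variable {F : Type*} [Field F]

/-- `diag(1, y) (p, q; r, s) diag(1, y)⁻¹ = (p, q y⁻¹; y r, s)`. [cite: LabesseLanglands1979, §2 (2.1) p. 8] -/
theorem diagonal_mul_mul_diagonal_inv_two {y : F} (hy : y ≠ 0) (p q r s : F) :
    Matrix.diagonal ![1, y] * !![p, q; r, s] * Matrix.diagonal ![1, y⁻¹] = !![p, q * y⁻¹; y * r, s] := by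
  have h := diagonal_inv_mul_mul_diagonal_two (inv_ne_zero hy) p q r s
  rwa [inv_inv] at h

variable (L : Type) [Field L] [NumberField L] [IsCMField L] (v : HeightOneSpectrum (𝓞 ↥(maximalRealSubfield L)))

omit [IsCMField L] in
/-- The matrix of `D_y := glDiagonal ![1, y]` (bookkeeping). [cite: LabesseLanglands1979, §2 (2.1) p. 8] -/
private theorem coe_glDiagonal_one_mk0_D {y : (v.adicCompletion ↥(maximalRealSubfield L))} (hy : y ≠ 0) :
    (((glDiagonal 2 (v.adicCompletion ↥(maximalRealSubfield L)) ![1, Units.mk0 (y) (hy)]) : GL (Fin 2) (v.adicCompletion ↥(maximalRealSubfield L))) : Matrix (Fin 2) (Fin 2) (v.adicCompletion ↥(maximalRealSubfield L))) = Matrix.diagonal ![1, y] := by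
  rw [coe_glDiagonal]
  congr 1
  funext k
  fin_cases k <;> rfl

omit [IsCMField L] in
/-- The matrix of `D_y⁻¹` (bookkeeping). [cite: LabesseLanglands1979, §2 (2.1) p. 8] -/
private theorem coe_glDiagonal_one_mk0_inv_D {y : (v.adicCompletion ↥(maximalRealSubfield L))} (hy : y ≠ 0) :
    ((((glDiagonal 2 (v.adicCompletion ↥(maximalRealSubfield L)) ![1, Units.mk0 (y) (hy)]))⁻¹ : GL (Fin 2) (v.adicCompletion ↥(maximalRealSubfield L))) : Matrix (Fin 2) (Fin 2) (v.adicCompletion ↥(maximalRealSubfield L))) = Matrix.diagonal ![1, y⁻¹] := by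
  rw [← map_inv, coe_glDiagonal]
  congr 1
  funext k
  fin_cases k <;> simp

/-- **Entrywise congruence to `1`**: if `M = (1, x; y, 1 + z)` with `|x|, |y|, |z| ≤ r` then every entry of `M − 1` has valuation `≤ r`.
[cite: LabesseLanglands1979, §2 (2.2) p. 9] -/
theorem forall_v_sub_one_le_of_eq {K : Type*} [Field K] {Γ₀ : Type*} [LinearOrderedCommGroupWithZero Γ₀] [Valued K Γ₀]
    {M : Matrix (Fin 2) (Fin 2) K} {x y z : K} {r : Γ₀} (hM : M = !![1, x; y, 1 + z])
    (hx : Valued.v x ≤ r) (hy : Valued.v y ≤ r) (hz : Valued.v z ≤ r) :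
    ∀ i k, Valued.v ((M - 1) i k) ≤ r := by
  have e00 : (M - 1) 0 0 = 0 := by rw [hM]; simp
  have e01 : (M - 1) 0 1 = x := by rw [hM]; simp
  have e10 : (M - 1) 1 0 = y := by rw [hM]; simp
  have e11 : (M - 1) 1 1 = z := by rw [hM]; simp
  intro i k
  fin_cases i <;> fin_cases k
  · simp only [Fin.zero_eta, Fin.isValue, e00, map_zero, zero_le]
  · simp only [Fin.zero_eta, Fin.mk_one, Fin.isValue, e01]; exact hx
  · simp only [Fin.zero_eta, Fin.mk_one, Fin.isValue, e10]; exact hy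
  · simp only [Fin.mk_one, Fin.isValue, e11]; exact hz

omit [IsCMField L] in
/-- **The shell window matrices are congruent to `1` modulo `𝔭^j` once `m + j ≤ o`**: for `|β|_v = exp(−o)`, `|c|_v = exp(−1)`, `|v₀|_v ≤ 1`, `|u₀|_v ≤ 1` and units
`y, y′` (`|y| = |y′| = 1`), every entry of `(1, β v₀ c^m y; y′ β c^{−m}, 1 + β u₀) − 1` has valuation `≤ exp(−j)`. [cite: LabesseLanglands1979, §2 (2.2) p. 9] -/
theorem forall_v_windowShell_sub_one_le {β c u₀ v₀ y y' : (v.adicCompletion ↥(maximalRealSubfield L))} {o m j : ℕ} (hβ : Valued.v β = WithZero.exp (-(o : ℤ))) (hvc : Valued.v c = WithZero.exp (-1 : ℤ))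
    (hv₀ : Valued.v v₀ ≤ 1) (hu₀ : Valued.v u₀ ≤ 1) (hy : Valued.v y = 1) (hy' : Valued.v y' = 1) (hm : m + j ≤ o) :
    ∀ i k, Valued.v ((!![(1 : (v.adicCompletion ↥(maximalRealSubfield L))), β * v₀ * c ^ m * y; y' * (β * (c ^ m)⁻¹), 1 + β * u₀] - 1) i k) ≤ WithZero.exp (-(j : ℤ)) := by
  have hjo : WithZero.exp (-(o : ℤ)) ≤ WithZero.exp (-(j : ℤ)) := WithZero.exp_le_exp.2 (by omega)
  have hcm : Valued.v (c ^ m) ≤ 1 := by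
    rw [map_pow, hvc, ← WithZero.exp_nsmul, ← WithZero.exp_zero, WithZero.exp_le_exp, nsmul_eq_mul]
    omega
  refine forall_v_sub_one_le_of_eq rfl ?_ ?_ ?_
  · rw [map_mul, map_mul, map_mul, hβ, hy, mul_one]
    calc WithZero.exp (-(o : ℤ)) * Valued.v v₀ * Valued.v (c ^ m) ≤ WithZero.exp (-(o : ℤ)) * 1 * 1 :=
          mul_le_mul' (mul_le_mul' le_rfl hv₀) hcm
      _ ≤ WithZero.exp (-(j : ℤ)) := by rw [mul_one, mul_one]; exact hjo
  · rw [map_mul, map_mul, map_inv₀, map_pow, hy', hβ, hvc, one_mul, ← WithZero.exp_nsmul, ← WithZero.exp_neg, ← WithZero.exp_add, WithZero.exp_le_exp,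
      nsmul_eq_mul]
    omega
  · rw [map_mul, hβ]
    calc WithZero.exp (-(o : ℤ)) * Valued.v u₀ ≤ WithZero.exp (-(o : ℤ)) * 1 := mul_le_mul' le_rfl hu₀
      _ ≤ WithZero.exp (-(j : ℤ)) := by rw [mul_one]; exact hjo

end Bookkeeping

/-! ## §2 The deep law -/

section Deep

variable (L : Type) [Field L] [NumberField L] [IsCMField L] (v : HeightOneSpectrum (𝓞 ↥(maximalRealSubfield L)))
  (w : PlacesOver L v) (hw : IsCMField.complexConj L • w.1 = w.1)
  [MeasurableSpace ((cmDatum L 2 (Matrix.of fun i j : Fin 2 => if i.val + j.val + 1 = 2 then (1 : L) else 0)).Local v × (cmDatum L 1 (Matrix.of fun i j : Fin 1 => if i.val + j.val + 1 = 1 then (1 : L) else 0)).Local v)] [BorelSpace ((cmDatum L 2 (Matrix.of fun i j : Fin 2 => if i.val + j.val + 1 = 2 then (1 : L) else 0)).Local v × (cmDatum L 1 (Matrix.of fun i j : Fin 1 => if i.val + j.val + 1 = 1 then (1 : L) else 0)).Local v)] (ν : Measure ((cmDatum L 2 (Matrix.of fun i j : Fin 2 => if i.val + j.val + 1 = 2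 then (1 : L) else 0)).Local v × (cmDatum L 1 (Matrix.of fun i j : Fin 1 => if i.val + j.val + 1 = 1 then (1 : L) else 0)).Local v))
  (f : ((cmDatum L 2 (Matrix.of fun i j : Fin 2 => if i.val + j.val + 1 = 2 then (1 : L) else 0)).Local v × (cmDatum L 1 (Matrix.of fun i j : Fin 1 => if i.val + j.val + 1 = 1 then (1 : L) else 0)).Local v) → ℂ) (hf : IsLocSmooth f)
  (t₀ : ((cmDatum L 2 (Matrix.of fun i j : Fin 2 => if i.val + j.val + 1 = 2 then (1 : L) else 0)).Local v × (cmDatum L 1 (Matrix.of fun i j : Fin 1 => if i.val + j.val + 1 = 1 then (1 : L) else 0)).Local v))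

-- `L_w`-sized statement: elaboration budget only (no search)
set_option maxHeartbeats 1600000 in
include hw hf in
/-- **(B6-V) THE DEEP LAW, POINTWISE**: there is a depth `j > 0` (★ B-p10's `j(f, K, α)`) such that for every `t ∈ Z(t₀)` with non-zero corner and Eisenstein
coordinate `β t` of valuation `exp(−o)`, the shell averages of `t` and of its partner `e t` AGREE at every shell `m` with `m + j ≤ o`:
`F̄_m(t) = F̄_m(e t)` — both shell conjugates descend to `ζ t · ι(S)` with `S ≡ 1 (mod 𝔭^j)` (§1). [cite: LabesseLanglands1979, §2 (2.2) p. 9]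
[cite: Labesse2024StabilisationGermesSL2, Prop. 0.0.11] [cite: Rogawski1990, §4.9 Lemma 4.9.3 p. 56] -/
theorem exists_depth_hdeep_of_coords
    (he : v.asIdeal.ramificationIdx' w.1.asIdeal ≠ 1)
    (u : ((w.1.adicCompletion L))ˣ) (hvu : Valued.v (u : (w.1.adicCompletion L)) = 1) (hσu : (galAdicCompletionMap (L := L) (IsCMField.complexConj L) hw) (u : (w.1.adicCompletion L)) = u) (hun : ¬ ∃ z : (w.1.adicCompletion L), (u : (w.1.adicCompletion L)) = (galAdicCompletionMap (L := L) (IsCMField.complexConj L) hw) z * z)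
    (E₂ : (cmDatum L 2 (Matrix.of fun i j : Fin 2 => if i.val + j.val + 1 = 2 then (1 : L) else 0)).Local v ≃ₜ* ↥(unitaryGroupOfForm (galAdicCompletionMap (L := L) (IsCMField.complexConj L) hw) (placeForm (Matrix.of fun i j : Fin 2 => if i.val + j.val + 1 = 2 then (1 : L) else 0) w.1)))
    (e : ((cmDatum L 2 (Matrix.of fun i j : Fin 2 => if i.val + j.val + 1 = 2 then (1 : L) else 0)).Local v × (cmDatum L 1 (Matrix.of fun i j : Fin 1 => if i.val + j.val + 1 = 1 then (1 : L) else 0)).Local v) ≃ₜ* ((cmDatum L 2 (Matrix.of fun i j : Fin 2 => if i.val + j.val + 1 = 2 then (1 : L) else 0)).Local v × (cmDatum L 1 (Matrix.of fun i j : Fin 1 => if i.val + j.val + 1 = 1 then (1 : L) else 0)).Local v)) (he2 : ∀ a : ((cmDatum L 2 (Matrix.of fun i j : Fin 2 => if i.val + j.val + 1 = 2 then (1 : L) else 0)).Local v × (cmDatum L 1 (Matrix.of fun i j : Fin 1 => if i.val + j.val + 1 = 1 then (1 : L) else 0)).Local v), (e a).2 = a.2)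
    (hconj : ∀ a : ((cmDatum L 2 (Matrix.of fun i j : Fin 2 => if i.val + j.val + 1 = 2 then (1 : L) else 0)).Local v × (cmDatum L 1 (Matrix.of fun i j : Fin 1 => if i.val + j.val + 1 = 1 then (1 : L) else 0)).Local v), ((E₂ (e a).1 : ↥(unitaryGroupOfForm (galAdicCompletionMap (L := L) (IsCMField.complexConj L) hw) (placeForm (Matrix.of fun i j : Fin 2 => if i.val + j.val + 1 = 2 then (1 : L) else 0) w.1))) : GL (Fin 2) (w.1.adicCompletion L)) = (glDiagonal 2 (w.1.adicCompletion L) ![1, u]) * ((E₂ a.1 : ↥(unitaryGroupOfForm (galAdicCompletionMap (L := L) (IsCMField.complexConj L) hw) (placeForm (Matrix.of fun i j : Fin 2 => if i.val + j.val + 1 = 2 then (1 : L) else 0) w.1))) : GL (Fin 2) (w.1.adicCompletion L)) * ((glDiagonal 2 (w.1.adicCompletion L) ![1, u]))⁻¹)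
    {α : (w.1.adicCompletion L)} (hα0 : α ≠ 0)
    {ϖF : (v.adicCompletion ↥(maximalRealSubfield L))} (hϖF : Valued.v ϖF = WithZero.exp (-1 : ℤ))
    (K : Subgroup ((cmDatum L 2 (Matrix.of fun i j : Fin 2 => if i.val + j.val + 1 = 2 then (1 : L) else 0)).Local v)) (hKo : IsOpen (((K).prod (⊤ : Subgroup ((cmDatum L 1 (Matrix.of fun i j : Fin 1 => if i.val + j.val + 1 = 1 then (1 : L) else 0)).Local v)) : Subgroup ((cmDatum L 2 (Matrix.of fun i j : Fin 2 => if i.val + j.val + 1 = 2 then (1 : L) else 0)).Local v × (cmDatum L 1 (Matrix.of fun i j : Fin 1 => if i.val + j.val + 1 = 1 then (1 : L) else 0)).Local v)) : Set ((cmDatum L 2 (Matrix.of fun i j : Fin 2 => if i.val + j.val + 1 = 2 then (1 : L) else 0)).Local v × (cmDatum L 1 (Matrix.of fun i j : Fin 1 => if i.val + j.val + 1 = 1 then (1 : L) else 0)).Local v))) (hKc : IsCompact (((K).prod (⊤ : Subgroup ((cmDatum L 1 (Matrix.of fun i j : Fin 1 => if i.val + j.val + 1 = 1 then (1 : L) else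 0)).Local v)) : Subgroup ((cmDatum L 2 (Matrix.of fun i j : Fin 2 => if i.val + j.val + 1 = 2 then (1 : L) else 0)).Local v × (cmDatum L 1 (Matrix.of fun i j : Fin 1 => if i.val + j.val + 1 = 1 then (1 : L) else 0)).Local v)) : Set ((cmDatum L 2 (Matrix.of fun i j : Fin 2 => if i.val + j.val + 1 = 2 then (1 : L) else 0)).Local v × (cmDatum L 1 (Matrix.of fun i j : Fin 1 => if i.val + j.val + 1 = 1 then (1 : L) else 0)).Local v)))
    {u₀ v₀ : (v.adicCompletion ↥(maximalRealSubfield L))} (hu : u₀ ∈ 𝒪[(v.adicCompletion ↥(maximalRealSubfield L))]) (hv1 : valuation (v.adicCompletion ↥(maximalRealSubfield L)) v₀ = valuation (v.adicCompletion ↥(maximalRealSubfield L)) ϖF)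
    (ηE : ((w.1.adicCompletion L))ˣ) (hηE : Valued.v (ηE : (w.1.adicCompletion L)) = WithZero.exp (-1 : ℤ))
    (uη : ↥(unitaryGroupOfForm (galAdicCompletionMap (L := L) (IsCMField.complexConj L) hw) (placeForm (Matrix.of fun i j : Fin 2 => if i.val + j.val + 1 = 2 then (1 : L) else 0) w.1))) (huη : (((uη : ↥(unitaryGroupOfForm (galAdicCompletionMap (L := L) (IsCMField.complexConj L) hw) (placeForm (Matrix.of fun i j : Fin 2 => if i.val + j.val + 1 = 2 then (1 : L) else 0) w.1))) : GL (Fin 2) (w.1.adicCompletion L)) : Matrix (Fin 2) (Fin 2) (w.1.adicCompletion L)) = Matrix.diagonal ![(ηE : (w.1.adicCompletion L)), ((galAdicCompletionMap (L := L) (IsCMField.complexConj L) hw) (ηE : (w.1.adicCompletion L)))⁻¹])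
    (ζ : ↥(Subgroup.centralizer ({t₀} : Set ((cmDatum L 2 (Matrix.of fun i j : Fin 2 => if i.val + j.val + 1 = 2 then (1 : L) else 0)).Local v × (cmDatum L 1 (Matrix.of fun i j : Fin 1 => if i.val + j.val + 1 = 1 then (1 : L) else 0)).Local v))) → (w.1.adicCompletion L)) (β : ↥(Subgroup.centralizer ({t₀} : Set ((cmDatum L 2 (Matrix.of fun i j : Fin 2 => if i.val + j.val + 1 = 2 then (1 : L) else 0)).Local v × (cmDatum L 1 (Matrix.of fun i j : Fin 1 => if i.val + j.val + 1 = 1 then (1 : L) else 0)).Local v))) → (v.adicCompletion ↥(maximalRealSubfield L)))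
    (hnf : ∀ t : ↥(Subgroup.centralizer ({t₀} : Set ((cmDatum L 2 (Matrix.of fun i j : Fin 2 => if i.val + j.val + 1 = 2 then (1 : L) else 0)).Local v × (cmDatum L 1 (Matrix.of fun i j : Fin 1 => if i.val + j.val + 1 = 1 then (1 : L) else 0)).Local v))), ((((E₂ (t : ((cmDatum L 2 (Matrix.of fun i j : Fin 2 => if i.val + j.val + 1 = 2 then (1 : L) else 0)).Local v × (cmDatum L 1 (Matrix.of fun i j : Fin 1 => if i.val + j.val + 1 = 1 then (1 : L) else 0)).Local v)).1) : ↥(unitaryGroupOfForm (galAdicCompletionMap (L := L) (IsCMField.complexConj L) hw) (placeForm (Matrix.of fun i j : Fin 2 => if i.val + j.val + 1 = 2 then (1 : L) else 0) w.1))) : GL (Fin 2) (w.1.adicCompletion L)) : Matrix (Fin 2) (Fin 2) (w.1.adicCompletion L)) 0 0 ≠ 0 →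
      Matrix.diagonal ![1, α] * ((((E₂ (t : ((cmDatum L 2 (Matrix.of fun i j : Fin 2 => if i.val + j.val + 1 = 2 then (1 : L) else 0)).Local v × (cmDatum L 1 (Matrix.of fun i j : Fin 1 => if i.val + j.val + 1 = 1 then (1 : L) else 0)).Local v)).1) : ↥(unitaryGroupOfForm (galAdicCompletionMap (L := L) (IsCMField.complexConj L) hw) (placeForm (Matrix.of fun i j : Fin 2 => if i.val + j.val + 1 = 2 then (1 : L) else 0) w.1))) : GL (Fin 2) (w.1.adicCompletion L)) : Matrix (Fin 2) (Fin 2) (w.1.adicCompletion L)) * Matrix.diagonal ![1, α⁻¹] = ζ t • (!![(1 : (v.adicCompletion ↥(maximalRealSubfield L))), β t * v₀; β t, 1 + β t * u₀]).map (toPlace v w)) :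
    ∃ j : ℕ, 0 < j ∧ ∀ t : ↥(Subgroup.centralizer ({t₀} : Set ((cmDatum L 2 (Matrix.of fun i j : Fin 2 => if i.val + j.val + 1 = 2 then (1 : L) else 0)).Local v × (cmDatum L 1 (Matrix.of fun i j : Fin 1 => if i.val + j.val + 1 = 1 then (1 : L) else 0)).Local v))), ((((E₂ (t : ((cmDatum L 2 (Matrix.of fun i j : Fin 2 => if i.val + j.val + 1 = 2 then (1 : L) else 0)).Local v × (cmDatum L 1 (Matrix.of fun i j : Fin 1 => if i.val + j.val + 1 = 1 then (1 : L) else 0)).Local v)).1) : ↥(unitaryGroupOfForm (galAdicCompletionMap (L := L) (IsCMField.complexConj L) hw) (placeForm (Matrix.of fun i j : Fin 2 => if i.val + j.val + 1 = 2 then (1 : L) else 0) w.1))) : GL (Fin 2) (w.1.adicCompletion L)) : Matrix (Fin 2) (Fin 2) (w.1.adicCompletion L)) 0 0 ≠ 0 → ∀ o : ℕ, Valued.v (β t) = WithZero.exp (-(o : ℤ)) → ∀ m : ℕ, m + j ≤ o →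
      (∫ k in (((K).prod (⊤ : Subgroup ((cmDatum L 1 (Matrix.of fun i j : Fin 1 => if i.val + j.val + 1 = 1 then (1 : L) else 0)).Local v)) : Subgroup ((cmDatum L 2 (Matrix.of fun i j : Fin 2 => if i.val + j.val + 1 = 2 then (1 : L) else 0)).Local v × (cmDatum L 1 (Matrix.of fun i j : Fin 1 => if i.val + j.val + 1 = 1 then (1 : L) else 0)).Local v)) : Set ((cmDatum L 2 (Matrix.of fun i j : Fin 2 => if i.val + j.val + 1 = 2 then (1 : L) else 0)).Local v × (cmDatum L 1 (Matrix.of fun i j : Fin 1 => if i.val + j.val + 1 = 1 then (1 : L) else 0)).Local v)), f (k⁻¹ * (((E₂.symm (uη⁻¹ ^ (m)), (1 : (cmDatum L 1 (Matrix.of fun i j : Fin 1 => if i.val + j.val + 1 = 1 then (1 : L) else 0)).Local v)) : ((cmDatum L 2 (Matrix.of fun i j : Fin 2 => if i.val + j.val + 1 = 2 then (1 : L) else 0)).Local v × (cmDatum L 1 (Matrix.of fun i j : Fin 1 => if i.val + j.val + 1 = 1 then (1 : L) else 0)).Local v))⁻¹ * (t : ((cmDatum L 2 (Matrix.of fun i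 j : Fin 2 => if i.val + j.val + 1 = 2 then (1 : L) else 0)).Local v × (cmDatum L 1 (Matrix.of fun i j : Fin 1 => if i.val + j.val + 1 = 1 then (1 : L) else 0)).Local v)) * (E₂.symm (uη⁻¹ ^ (m)), 1)) * k) ∂ν) =
      (∫ k in (((K).prod (⊤ : Subgroup ((cmDatum L 1 (Matrix.of fun i j : Fin 1 => if i.val + j.val + 1 = 1 then (1 : L) else 0)).Local v)) : Subgroup ((cmDatum L 2 (Matrix.of fun i j : Fin 2 => if i.val + j.val + 1 = 2 then (1 : L) else 0)).Local v × (cmDatum L 1 (Matrix.of fun i j : Fin 1 => if i.val + j.val + 1 = 1 then (1 : L) else 0)).Local v)) : Set ((cmDatum L 2 (Matrix.of fun i j : Fin 2 => if i.val + j.val + 1 = 2 then (1 : L) else 0)).Local v × (cmDatum L 1 (Matrix.of fun i j : Fin 1 => if i.val + j.val + 1 = 1 then (1 : L) else 0)).Local v)), f (k⁻¹ * (((E₂.symm (uη⁻¹ ^ (m)), (1 : (cmDatum L 1 (Matrix.of fun i j : Fin 1 => if i.val + j.val + 1 = 1 then (1 : L) else 0)).Local v)) : ((cmDatum L 2 (Matrix.of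 fun i j : Fin 2 => if i.val + j.val + 1 = 2 then (1 : L) else 0)).Local v × (cmDatum L 1 (Matrix.of fun i j : Fin 1 => if i.val + j.val + 1 = 1 then (1 : L) else 0)).Local v))⁻¹ * (e (t : ((cmDatum L 2 (Matrix.of fun i j : Fin 2 => if i.val + j.val + 1 = 2 then (1 : L) else 0)).Local v × (cmDatum L 1 (Matrix.of fun i j : Fin 1 => if i.val + j.val + 1 = 1 then (1 : L) else 0)).Local v))) * (E₂.symm (uη⁻¹ ^ (m)), 1)) * k) ∂ν) := by
  -- §0 data at the place
  obtain ⟨uF, huF0, huF1, -, huu⟩ := exists_unit_toPlace_eq_of_not_exists_norm L v w hw u hvu hσu hun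
  obtain ⟨c, hc0, hc, hvc⟩ := exists_uniformizer_toPlace_eq_mul L v w hw he ηE hηE
  have hη0 : (ηE : (w.1.adicCompletion L)) ≠ 0 := ηE.ne_zero
  have hiso := ValuativeRel.isEquiv (valuation (v.adicCompletion ↥(maximalRealSubfield L))) (Valued.v : Valuation (v.adicCompletion ↥(maximalRealSubfield L)) (WithZero (Multiplicative ℤ)))
  have hvuF : Valued.v uF = 1 := hiso.eq_one_iff_eq_one.1 huF1
  have hvuF' : Valued.v uF⁻¹ = 1 := by rw [map_inv₀, hvuF, inv_one]
  have hv₀ : Valued.v v₀ ≤ 1 := by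
    have h : Valued.v v₀ = Valued.v ϖF := (hiso.eq_iff).1 hv1
    rw [h, hϖF, ← WithZero.exp_zero, WithZero.exp_le_exp]
    norm_num
  have hu₀ : Valued.v u₀ ≤ 1 := hiso.le_one_iff_le_one.1 ((Valuation.mem_integer_iff _ _).1 hu)
  -- the depth (★ B-p10)
  obtain ⟨j, hj0, hj⟩ := exists_depth_shellAverage_eq_of_descent_congr' L v w hw hα0 ν f hf K hKo hKc E₂
  refine ⟨j, hj0, fun t h0 o hβv m hm => ?_⟩
  -- the descended torus element `γ = (1, β v₀; β, 1 + β u₀) ∈ GL₂(L⁺_v)`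
  have hT := hnf t h0
  have hdet : (!![(1 : (v.adicCompletion ↥(maximalRealSubfield L))), β t * v₀; β t, 1 + β t * u₀]).det ≠ 0 := det_ne_zero_of_descent (toPlace v w) hα0 _ hT
  obtain ⟨γ, hγ⟩ : ∃ γ : GL (Fin 2) (v.adicCompletion ↥(maximalRealSubfield L)), ((γ : GL (Fin 2) (v.adicCompletion ↥(maximalRealSubfield L))) : Matrix (Fin 2) (Fin 2) (v.adicCompletion ↥(maximalRealSubfield L))) = !![(1 : (v.adicCompletion ↥(maximalRealSubfield L))), β t * v₀; β t, 1 + β t * u₀] :=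
    ⟨Matrix.GeneralLinearGroup.mk'' _ (isUnit_iff_ne_zero.2 hdet), rfl⟩
  have hTγ : Matrix.diagonal ![1, α] * ((((E₂ (t : ((cmDatum L 2 (Matrix.of fun i j : Fin 2 => if i.val + j.val + 1 = 2 then (1 : L) else 0)).Local v × (cmDatum L 1 (Matrix.of fun i j : Fin 1 => if i.val + j.val + 1 = 1 then (1 : L) else 0)).Local v)).1) : ↥(unitaryGroupOfForm (galAdicCompletionMap (L := L) (IsCMField.complexConj L) hw) (placeForm (Matrix.of fun i j : Fin 2 => if i.val + j.val + 1 = 2 then (1 : L) else 0) w.1))) : GL (Fin 2) (w.1.adicCompletion L)) : Matrix (Fin 2) (Fin 2) (w.1.adicCompletion L)) * Matrix.diagonal ![1, α⁻¹] = ζ t • (((γ : GL (Fin 2) (v.adicCompletion ↥(maximalRealSubfield L))) : Matrix (Fin 2) (Fin 2) (v.adicCompletion ↥(maximalRealSubfield L)))).map (toPlace v w) := by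
    rw [hγ]; exact hT
  -- the shell conjugate of `X_t` descends to `ζ t · ι((D_c^m)⁻¹ γ D_c^m)`
  have hX := descent_shellConjugate L v w hw hα0 uη (E₂ (t : ((cmDatum L 2 (Matrix.of fun i j : Fin 2 => if i.val + j.val + 1 = 2 then (1 : L) else 0)).Local v × (cmDatum L 1 (Matrix.of fun i j : Fin 1 => if i.val + j.val + 1 = 1 then (1 : L) else 0)).Local v)).1) hη0 huη hc0 hc m hTγ
  have hS : ((((glDiagonal 2 (v.adicCompletion ↥(maximalRealSubfield L)) ![1, Units.mk0 (c) (hc0)]) ^ m)⁻¹ * γ * (glDiagonal 2 (v.adicCompletion ↥(maximalRealSubfield L)) ![1, Units.mk0 (c) (hc0)]) ^ m : GL (Fin 2) (v.adicCompletion ↥(maximalRealSubfield L))) : Matrix (Fin 2) (Fin 2) (v.adicCompletion ↥(maximalRealSubfield L))) =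
      !![(1 : (v.adicCompletion ↥(maximalRealSubfield L))), β t * v₀ * c ^ m; β t * (c ^ m)⁻¹, 1 + β t * u₀] :=
    coe_glDiagonal_pow_conj_regRep L v hc0 m u₀ v₀ 1 (β t) hγ
  -- the partner `X_{e t} = D_u X_t D_u⁻¹` descends to `ζ t · ι(D_{u_F} γ D_{u_F}⁻¹)`, its shell conjugate to `ζ t · ι(D_{u_F} (D_c^m)⁻¹ γ D_c^m D_{u_F}⁻¹)`
  have hd1 : (((glDiagonal 2 (w.1.adicCompletion L) ![1, u]) : GL (Fin 2) (w.1.adicCompletion L)) : Matrix (Fin 2) (Fin 2) (w.1.adicCompletion L)) = Matrix.diagonal ![1, toPlace v w uF] := by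
    rw [coe_glDiagonal]
    congr 1
    funext k
    fin_cases k <;> simp [huu]
  have hd2 : ((((glDiagonal 2 (w.1.adicCompletion L) ![1, u]))⁻¹ : GL (Fin 2) (w.1.adicCompletion L)) : Matrix (Fin 2) (Fin 2) (w.1.adicCompletion L)) = Matrix.diagonal ![1, (toPlace v w uF)⁻¹] := by
    rw [← map_inv, coe_glDiagonal]
    congr 1
    funext k
    fin_cases k <;> simp [huu]
  have hT'mat : ((((E₂ (e (t : ((cmDatum L 2 (Matrix.of fun i j : Fin 2 => if i.val + j.val + 1 = 2 then (1 : L) else 0)).Local v × (cmDatum L 1 (Matrix.of fun i j : Fin 1 => if i.val + j.val + 1 = 1 then (1 : L) else 0)).Local v))).1) : ↥(unitaryGroupOfForm (galAdicCompletionMap (L := L) (IsCMField.complexConj L) hw) (placeForm (Matrix.of fun i j : Fin 2 => if i.val + j.val + 1 = 2 then (1 : L) else 0) w.1))) : GL (Fin 2) (w.1.adicCompletion L)) : Matrix (Fin 2) (Fin 2) (w.1.adicCompletion L)) = Matrix.diagonal ![1, toPlace v w uF] * ((((E₂ (t : ((cmDatum L 2 (Matrix.of fun i j : Fin 2 =>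 if i.val + j.val + 1 = 2 then (1 : L) else 0)).Local v × (cmDatum L 1 (Matrix.of fun i j : Fin 1 => if i.val + j.val + 1 = 1 then (1 : L) else 0)).Local v)).1) : ↥(unitaryGroupOfForm (galAdicCompletionMap (L := L) (IsCMField.complexConj L) hw) (placeForm (Matrix.of fun i j : Fin 2 => if i.val + j.val + 1 = 2 then (1 : L) else 0) w.1))) : GL (Fin 2) (w.1.adicCompletion L)) : Matrix (Fin 2) (Fin 2) (w.1.adicCompletion L)) * Matrix.diagonal ![1, (toPlace v w uF)⁻¹] := by
    rw [hconj, Units.val_mul, Units.val_mul, hd1, hd2]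
  have hT'desc : Matrix.diagonal ![1, α] * ((((E₂ (e (t : ((cmDatum L 2 (Matrix.of fun i j : Fin 2 => if i.val + j.val + 1 = 2 then (1 : L) else 0)).Local v × (cmDatum L 1 (Matrix.of fun i j : Fin 1 => if i.val + j.val + 1 = 1 then (1 : L) else 0)).Local v))).1) : ↥(unitaryGroupOfForm (galAdicCompletionMap (L := L) (IsCMField.complexConj L) hw) (placeForm (Matrix.of fun i j : Fin 2 => if i.val + j.val + 1 = 2 then (1 : L) else 0) w.1))) : GL (Fin 2) (w.1.adicCompletion L)) : Matrix (Fin 2) (Fin 2) (w.1.adicCompletion L)) * Matrix.diagonal ![1, α⁻¹] = ζ t • ((((glDiagonal 2 (v.adicCompletion ↥(maximalRealSubfield L)) ![1, Units.mk0 (uF) (huF0)]) * γ * (glDiagonal 2 (v.adicCompletion ↥(maximalRealSubfield L)) ![1, Units.mk0 (uF) (huF0)])⁻¹ : GL (Fin 2) (v.adicCompletion ↥(maximalRealSubfield L))) : Matrix (Fin 2) (Fin 2) (v.adicCompletion ↥(maximalRealSubfield L)))).map (toPlace v w) := by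
    rw [hT'mat, descent_conj_diagonal_eq (toPlace v w) α uF hTγ, Units.val_mul, Units.val_mul, coe_glDiagonal_one_mk0_D L v huF0, coe_glDiagonal_one_mk0_inv_D L v huF0]
  have hY₀ := descent_shellConjugate L v w hw hα0 uη (E₂ (e (t : ((cmDatum L 2 (Matrix.of fun i j : Fin 2 => if i.val + j.val + 1 = 2 then (1 : L) else 0)).Local v × (cmDatum L 1 (Matrix.of fun i j : Fin 1 => if i.val + j.val + 1 = 1 then (1 : L) else 0)).Local v))).1) hη0 huη hc0 hc m hT'desc
  have hcomm : Commute ((glDiagonal 2 (v.adicCompletion ↥(maximalRealSubfield L)) ![1, Units.mk0 (c) (hc0)]) ^ m) (glDiagonal 2 (v.adicCompletion ↥(maximalRealSubfield L)) ![1, Units.mk0 (uF) (huF0)]) := (commute_glDiagonal 2 (v.adicCompletion ↥(maximalRealSubfield L)) _ _).pow_left m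
  rw [conj_conj_eq_of_commute hcomm] at hY₀
  have hS' : (((glDiagonal 2 (v.adicCompletion ↥(maximalRealSubfield L)) ![1, Units.mk0 (uF) (huF0)]) * ((((glDiagonal 2 (v.adicCompletion ↥(maximalRealSubfield L)) ![1, Units.mk0 (c) (hc0)]) ^ m)⁻¹ * γ * (glDiagonal 2 (v.adicCompletion ↥(maximalRealSubfield L)) ![1, Units.mk0 (c) (hc0)]) ^ m)) * (glDiagonal 2 (v.adicCompletion ↥(maximalRealSubfield L)) ![1, Units.mk0 (uF) (huF0)])⁻¹ : GL (Fin 2) (v.adicCompletion ↥(maximalRealSubfield L))) : Matrix (Fin 2) (Fin 2) (v.adicCompletion ↥(maximalRealSubfield L))) =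
      !![(1 : (v.adicCompletion ↥(maximalRealSubfield L))), β t * v₀ * c ^ m * uF⁻¹; uF * (β t * (c ^ m)⁻¹), 1 + β t * u₀] := by
    rw [Units.val_mul, Units.val_mul, coe_glDiagonal_one_mk0_D L v huF0, coe_glDiagonal_one_mk0_inv_D L v huF0, hS, diagonal_mul_mul_diagonal_inv_two huF0]
  -- congruences `S ≡ 1 ≡ S′ (mod 𝔭^j)` from `m + j ≤ o`
  have hS1 := forall_v_windowShell_sub_one_le L v (y := 1) (y' := 1) hβv hvc hv₀ hu₀ (map_one _) (map_one _) hm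
  have hS'1 := forall_v_windowShell_sub_one_le L v (y := uF⁻¹) (y' := uF) hβv hvc hv₀ hu₀ hvuF' hvuF hm
  simp only [mul_one, one_mul] at hS1
  rw [← hS] at hS1
  rw [← hS'] at hS'1
  exact hj (uη⁻¹ ^ m) (t : ((cmDatum L 2 (Matrix.of fun i j : Fin 2 => if i.val + j.val + 1 = 2 then (1 : L) else 0)).Local v × (cmDatum L 1 (Matrix.of fun i j : Fin 1 => if i.val + j.val + 1 = 1 then (1 : L) else 0)).Local v)) (e (t : ((cmDatum L 2 (Matrix.of fun i j : Fin 2 => if i.val + j.val + 1 = 2 then (1 : L) else 0)).Local v × (cmDatum L 1 (Matrix.of fun i j : Fin 1 => if i.val + j.val + 1 = 1 then (1 : L) else 0)).Local v))) (ζ t) _ _ (he2 (t : ((cmDatum L 2 (Matrix.of fun i j : Fin 2 => if i.val + j.val + 1 = 2 then (1 : L) else 0)).Local v × (cmDatum L 1 (Matrix.of fun i j : Fin 1 => if i.val + j.val + 1 = 1 then (1 : L) else 0)).Local v))) hX hY₀ hS1 hS'1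

omit [BorelSpace ((cmDatum L 2 (Matrix.of fun i j : Fin 2 => if i.val + j.val + 1 = 2 then (1 : L) else 0)).Local v × (cmDatum L 1 (Matrix.of fun i j : Fin 1 => if i.val + j.val + 1 = 1 then (1 : L) else 0)).Local v)] in
/-- **(B6-V) `hdeep` IN THE HEAD'S TEXT** from the pointwise deep law: on the deep regular locus (`h00` non-zero corner, `hoT` the depth reading `|β t| = exp(−oT t)`)
the shell averages of `t` and `e t` agree at all shells `m + j ≤ oT t`. [cite: LabesseLanglands1979, §2 (2.2) p. 9] -/
theorem hdeep_of_pointwise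
    (E₂ : (cmDatum L 2 (Matrix.of fun i j : Fin 2 => if i.val + j.val + 1 = 2 then (1 : L) else 0)).Local v ≃ₜ* ↥(unitaryGroupOfForm (galAdicCompletionMap (L := L) (IsCMField.complexConj L) hw) (placeForm (Matrix.of fun i j : Fin 2 => if i.val + j.val + 1 = 2 then (1 : L) else 0) w.1))) (e : ((cmDatum L 2 (Matrix.of fun i j : Fin 2 => if i.val + j.val + 1 = 2 then (1 : L) else 0)).Local v × (cmDatum L 1 (Matrix.of fun i j : Fin 1 => if i.val + j.val + 1 = 1 then (1 : L) else 0)).Local v) ≃ₜ* ((cmDatum L 2 (Matrix.of fun i j : Fin 2 => if i.val + j.val + 1 = 2 then (1 : L) else 0)).Local v × (cmDatum L 1 (Matrix.of fun i j : Fin 1 => if i.val + j.val + 1 = 1 then (1 : L) else 0)).Local v)) (K : Subgroup ((cmDatum L 2 (Matrix.of fun i j : Fin 2 => if i.val + j.val + 1 = 2 then (1 : L) else 0)).Local v)) (uη : ↥(unitaryGroupOfForm (galAdicCompletionMap (L := L) (IsCMField.complexConj L) hw) (placeForm (Matrix.of fun i j : Fin 2 => if i.val + j.val + 1 = 2 then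 (1 : L) else 0) w.1)))
    (P : GL (Fin 2) (LocalRing L v))
    (mfl j : ℕ) (β : ↥(Subgroup.centralizer ({t₀} : Set ((cmDatum L 2 (Matrix.of fun i j : Fin 2 => if i.val + j.val + 1 = 2 then (1 : L) else 0)).Local v × (cmDatum L 1 (Matrix.of fun i j : Fin 1 => if i.val + j.val + 1 = 1 then (1 : L) else 0)).Local v))) → (v.adicCompletion ↥(maximalRealSubfield L))) (oT : ↥(Subgroup.centralizer ({t₀} : Set ((cmDatum L 2 (Matrix.of fun i j : Fin 2 => if i.val + j.val + 1 = 2 then (1 : L) else 0)).Local v × (cmDatum L 1 (Matrix.of fun i j : Fin 1 => if i.val + j.val + 1 = 1 then (1 : L) else 0)).Local v))) → ℕ)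
    (h00 : ∀ t : ↥(Subgroup.centralizer ({t₀} : Set ((cmDatum L 2 (Matrix.of fun i j : Fin 2 => if i.val + j.val + 1 = 2 then (1 : L) else 0)).Local v × (cmDatum L 1 (Matrix.of fun i j : Fin 1 => if i.val + j.val + 1 = 1 then (1 : L) else 0)).Local v))), t ∈ {t : ↥(Subgroup.centralizer ({t₀} : Set ((cmDatum L 2 (Matrix.of fun i j : Fin 2 => if i.val + j.val + 1 = 2 then (1 : L) else 0)).Local v × (cmDatum L 1 (Matrix.of fun i j : Fin 1 => if i.val + j.val + 1 = 1 then (1 : L) else 0)).Local v))) | IsRegularElt ((t : ((cmDatum L 2 (Matrix.of fun i j : Fin 2 => if i.val + j.val + 1 = 2 then (1 : L) else 0)).Local v × (cmDatum L 1 (Matrix.of fun i j : Fin 1 => if i.val + j.val + 1 = 1 then (1 : L) else 0)).Local v)).1.val : GL (Fin 2) (LocalRing L v))} → mfl ≤ (-WithZero.log (Valued.v ((((P⁻¹).val * ((t : ((cmDatum L 2 (Matrix.of fun i j : Fin 2 => if i.val + j.val + 1 = 2 then (1 : L) else 0)).Local v × (cmDatum L 1 (Matrix.of fun i j : Fin 1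 => if i.val + j.val + 1 = 1 then (1 : L) else 0)).Local v)).1.val.val : Matrix (Fin 2) (Fin 2) (LocalRing L v)) * P.val) 0 0 - ((P⁻¹).val * ((t : ((cmDatum L 2 (Matrix.of fun i j : Fin 2 => if i.val + j.val + 1 = 2 then (1 : L) else 0)).Local v × (cmDatum L 1 (Matrix.of fun i j : Fin 1 => if i.val + j.val + 1 = 1 then (1 : L) else 0)).Local v)).1.val.val : Matrix (Fin 2) (Fin 2) (LocalRing L v)) * P.val) 1 1) w))).toNat → ((((E₂ (t : ((cmDatum L 2 (Matrix.of fun i j : Fin 2 => if i.val + j.val + 1 = 2 then (1 : L) else 0)).Local v × (cmDatum L 1 (Matrix.of fun i j : Fin 1 => if i.val + j.val + 1 = 1 then (1 : L) else 0)).Local v)).1) : ↥(unitaryGroupOfForm (galAdicCompletionMap (L := L) (IsCMField.complexConj L) hw) (placeForm (Matrix.of fun i j : Fin 2 => if i.val + j.val + 1 = 2 then (1 : L) else 0) w.1))) : GL (Fin 2) (w.1.adicCompletion L)) : Matrix (Fin 2) (Fin 2) (w.1.adicCompletion L)) 0 0 ≠ 0)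
    (hoT : ∀ t : ↥(Subgroup.centralizer ({t₀} : Set ((cmDatum L 2 (Matrix.of fun i j : Fin 2 => if i.val + j.val + 1 = 2 then (1 : L) else 0)).Local v × (cmDatum L 1 (Matrix.of fun i j : Fin 1 => if i.val + j.val + 1 = 1 then (1 : L) else 0)).Local v))), t ∈ {t : ↥(Subgroup.centralizer ({t₀} : Set ((cmDatum L 2 (Matrix.of fun i j : Fin 2 => if i.val + j.val + 1 = 2 then (1 : L) else 0)).Local v × (cmDatum L 1 (Matrix.of fun i j : Fin 1 => if i.val + j.val + 1 = 1 then (1 : L) else 0)).Local v))) | IsRegularElt ((t : ((cmDatum L 2 (Matrix.of fun i j : Fin 2 => if i.val + j.val + 1 = 2 then (1 : L) else 0)).Local v × (cmDatum L 1 (Matrix.of fun i j : Fin 1 => if i.val + j.val + 1 = 1 then (1 : L) else 0)).Local v)).1.val : GL (Fin 2) (LocalRing L v))} → mfl ≤ (-WithZero.log (Valued.v ((((P⁻¹).val * ((t : ((cmDatum L 2 (Matrix.of fun i j : Fin 2 => if i.val + j.val + 1 = 2 then (1 : L) else 0)).Local v × (cmDatum L 1 (Matrix.of fun i j : Fin 1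 => if i.val + j.val + 1 = 1 then (1 : L) else 0)).Local v)).1.val.val : Matrix (Fin 2) (Fin 2) (LocalRing L v)) * P.val) 0 0 - ((P⁻¹).val * ((t : ((cmDatum L 2 (Matrix.of fun i j : Fin 2 => if i.val + j.val + 1 = 2 then (1 : L) else 0)).Local v × (cmDatum L 1 (Matrix.of fun i j : Fin 1 => if i.val + j.val + 1 = 1 then (1 : L) else 0)).Local v)).1.val.val : Matrix (Fin 2) (Fin 2) (LocalRing L v)) * P.val) 1 1) w))).toNat → j ≤ oT t ∧ Valued.v (β t) = WithZero.exp (-(oT t : ℤ)))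
    (hj : ∀ t : ↥(Subgroup.centralizer ({t₀} : Set ((cmDatum L 2 (Matrix.of fun i j : Fin 2 => if i.val + j.val + 1 = 2 then (1 : L) else 0)).Local v × (cmDatum L 1 (Matrix.of fun i j : Fin 1 => if i.val + j.val + 1 = 1 then (1 : L) else 0)).Local v))), ((((E₂ (t : ((cmDatum L 2 (Matrix.of fun i j : Fin 2 => if i.val + j.val + 1 = 2 then (1 : L) else 0)).Local v × (cmDatum L 1 (Matrix.of fun i j : Fin 1 => if i.val + j.val + 1 = 1 then (1 : L) else 0)).Local v)).1) : ↥(unitaryGroupOfForm (galAdicCompletionMap (L := L) (IsCMField.complexConj L) hw) (placeForm (Matrix.of fun i j : Fin 2 => if i.val + j.val + 1 = 2 then (1 : L) else 0) w.1))) : GL (Fin 2) (w.1.adicCompletion L)) : Matrix (Fin 2) (Fin 2) (w.1.adicCompletion L)) 0 0 ≠ 0 → ∀ o : ℕ, Valued.v (β t) = WithZero.exp (-(o : ℤ)) → ∀ m : ℕ, m + j ≤ o →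
      (∫ k in (((K).prod (⊤ : Subgroup ((cmDatum L 1 (Matrix.of fun i j : Fin 1 => if i.val + j.val + 1 = 1 then (1 : L) else 0)).Local v)) : Subgroup ((cmDatum L 2 (Matrix.of fun i j : Fin 2 => if i.val + j.val + 1 = 2 then (1 : L) else 0)).Local v × (cmDatum L 1 (Matrix.of fun i j : Fin 1 => if i.val + j.val + 1 = 1 then (1 : L) else 0)).Local v)) : Set ((cmDatum L 2 (Matrix.of fun i j : Fin 2 => if i.val + j.val + 1 = 2 then (1 : L) else 0)).Local v × (cmDatum L 1 (Matrix.of fun i j : Fin 1 => if i.val + j.val + 1 = 1 then (1 : L) else 0)).Local v)), f (k⁻¹ * (((E₂.symm (uη⁻¹ ^ (m)), (1 : (cmDatum L 1 (Matrix.of fun i j : Fin 1 => if i.val + j.val + 1 = 1 then (1 : L) else 0)).Local v)) : ((cmDatum L 2 (Matrix.of fun i j : Fin 2 => if i.val + j.val + 1 = 2 then (1 : L) else 0)).Local v × (cmDatum L 1 (Matrix.of fun i j : Fin 1 => if i.val + j.val + 1 = 1 then (1 : L) else 0)).Local v))⁻¹ * (t : ((cmDatum L 2 (Matrix.of fun i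 j : Fin 2 => if i.val + j.val + 1 = 2 then (1 : L) else 0)).Local v × (cmDatum L 1 (Matrix.of fun i j : Fin 1 => if i.val + j.val + 1 = 1 then (1 : L) else 0)).Local v)) * (E₂.symm (uη⁻¹ ^ (m)), 1)) * k) ∂ν) =
      (∫ k in (((K).prod (⊤ : Subgroup ((cmDatum L 1 (Matrix.of fun i j : Fin 1 => if i.val + j.val + 1 = 1 then (1 : L) else 0)).Local v)) : Subgroup ((cmDatum L 2 (Matrix.of fun i j : Fin 2 => if i.val + j.val + 1 = 2 then (1 : L) else 0)).Local v × (cmDatum L 1 (Matrix.of fun i j : Fin 1 => if i.val + j.val + 1 = 1 then (1 : L) else 0)).Local v)) : Set ((cmDatum L 2 (Matrix.of fun i j : Fin 2 => if i.val + j.val + 1 = 2 then (1 : L) else 0)).Local v × (cmDatum L 1 (Matrix.of fun i j : Fin 1 => if i.val + j.val + 1 = 1 then (1 : L) else 0)).Local v)), f (k⁻¹ * (((E₂.symm (uη⁻¹ ^ (m)), (1 : (cmDatum L 1 (Matrix.of fun i j : Fin 1 => if i.val + j.val + 1 = 1 then (1 : L) else 0)).Local v)) : ((cmDatum L 2 (Matrix.of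 fun i j : Fin 2 => if i.val + j.val + 1 = 2 then (1 : L) else 0)).Local v × (cmDatum L 1 (Matrix.of fun i j : Fin 1 => if i.val + j.val + 1 = 1 then (1 : L) else 0)).Local v))⁻¹ * (e (t : ((cmDatum L 2 (Matrix.of fun i j : Fin 2 => if i.val + j.val + 1 = 2 then (1 : L) else 0)).Local v × (cmDatum L 1 (Matrix.of fun i j : Fin 1 => if i.val + j.val + 1 = 1 then (1 : L) else 0)).Local v))) * (E₂.symm (uη⁻¹ ^ (m)), 1)) * k) ∂ν)) :
    (∀ t : ↥(Subgroup.centralizer ({t₀} : Set ((cmDatum L 2 (Matrix.of fun i j : Fin 2 => if i.val + j.val + 1 = 2 then (1 : L) else 0)).Local v × (cmDatum L 1 (Matrix.of fun i j : Fin 1 => if i.val + j.val + 1 = 1 then (1 : L) else 0)).Local v))), t ∈ {t : ↥(Subgroup.centralizer ({t₀} : Set ((cmDatum L 2 (Matrix.of fun i j : Fin 2 => if i.val + j.val + 1 = 2 then (1 : L) else 0)).Local v × (cmDatum L 1 (Matrix.of fun i j : Fin 1 => if i.val + j.val + 1 = 1 then (1 : L) else 0)).Local v))) | IsRegularElt ((t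 : ((cmDatum L 2 (Matrix.of fun i j : Fin 2 => if i.val + j.val + 1 = 2 then (1 : L) else 0)).Local v × (cmDatum L 1 (Matrix.of fun i j : Fin 1 => if i.val + j.val + 1 = 1 then (1 : L) else 0)).Local v)).1.val : GL (Fin 2) (LocalRing L v))} → mfl ≤ (-WithZero.log (Valued.v ((((P⁻¹).val * ((t : ((cmDatum L 2 (Matrix.of fun i j : Fin 2 => if i.val + j.val + 1 = 2 then (1 : L) else 0)).Local v × (cmDatum L 1 (Matrix.of fun i j : Fin 1 => if i.val + j.val + 1 = 1 then (1 : L) else 0)).Local v)).1.val.val : Matrix (Fin 2) (Fin 2) (LocalRing L v)) * P.val) 0 0 - ((P⁻¹).val * ((t : ((cmDatum L 2 (Matrix.of fun i j : Fin 2 => if i.val + j.val + 1 = 2 then (1 : L) else 0)).Local v × (cmDatum L 1 (Matrix.of fun i j : Fin 1 => if i.val + j.val + 1 = 1 then (1 : L) else 0)).Local v)).1.val.val : Matrix (Fin 2) (Fin 2) (LocalRing L v)) * P.val) 1 1) w))).toNat → ∀ m, m + j ≤ oT t → (∫ k in (((K).prod (⊤ : Subgroup ((cmDatum L 1 (Matrix.of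 fun i j : Fin 1 => if i.val + j.val + 1 = 1 then (1 : L) else 0)).Local v)) : Subgroup ((cmDatum L 2 (Matrix.of fun i j : Fin 2 => if i.val + j.val + 1 = 2 then (1 : L) else 0)).Local v × (cmDatum L 1 (Matrix.of fun i j : Fin 1 => if i.val + j.val + 1 = 1 then (1 : L) else 0)).Local v)) : Set ((cmDatum L 2 (Matrix.of fun i j : Fin 2 => if i.val + j.val + 1 = 2 then (1 : L) else 0)).Local v × (cmDatum L 1 (Matrix.of fun i j : Fin 1 => if i.val + j.val + 1 = 1 then (1 : L) else 0)).Local v)), f (k⁻¹ * (((E₂.symm (uη⁻¹ ^ (m)), (1 : (cmDatum L 1 (Matrix.of fun i j : Fin 1 => if i.val + j.val + 1 = 1 then (1 : L) else 0)).Local v)) : ((cmDatum L 2 (Matrix.of fun i j : Fin 2 => if i.val + j.val + 1 = 2 then (1 : L) else 0)).Local v × (cmDatum L 1 (Matrix.of fun i j : Fin 1 => if i.val + j.val + 1 = 1 then (1 : L) else 0)).Local v))⁻¹ * ((t : ((cmDatum L 2 (Matrix.of fun i j : Fin 2 => if i.val + j.val + 1 = 2 then (1 : L) else 0)).Local v ×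 (cmDatum L 1 (Matrix.of fun i j : Fin 1 => if i.val + j.val + 1 = 1 then (1 : L) else 0)).Local v))) * (E₂.symm (uη⁻¹ ^ (m)), 1)) * k) ∂ν) = (∫ k in (((K).prod (⊤ : Subgroup ((cmDatum L 1 (Matrix.of fun i j : Fin 1 => if i.val + j.val + 1 = 1 then (1 : L) else 0)).Local v)) : Subgroup ((cmDatum L 2 (Matrix.of fun i j : Fin 2 => if i.val + j.val + 1 = 2 then (1 : L) else 0)).Local v × (cmDatum L 1 (Matrix.of fun i j : Fin 1 => if i.val + j.val + 1 = 1 then (1 : L) else 0)).Local v)) : Set ((cmDatum L 2 (Matrix.of fun i j : Fin 2 => if i.val + j.val + 1 = 2 then (1 : L) else 0)).Local v × (cmDatum L 1 (Matrix.of fun i j : Fin 1 => if i.val + j.val + 1 = 1 then (1 : L) else 0)).Local v)), f (k⁻¹ * (((E₂.symm (uη⁻¹ ^ (m)), (1 : (cmDatum L 1 (Matrix.of fun i j : Fin 1 => if i.val + j.val + 1 = 1 then (1 : L) else 0)).Local v)) : ((cmDatum L 2 (Matrix.of fun i j : Fin 2 => if i.val + j.val + 1 = 2 then (1 : L) else 0)).Local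 v × (cmDatum L 1 (Matrix.of fun i j : Fin 1 => if i.val + j.val + 1 = 1 then (1 : L) else 0)).Local v))⁻¹ * (e (t : ((cmDatum L 2 (Matrix.of fun i j : Fin 2 => if i.val + j.val + 1 = 2 then (1 : L) else 0)).Local v × (cmDatum L 1 (Matrix.of fun i j : Fin 1 => if i.val + j.val + 1 = 1 then (1 : L) else 0)).Local v))) * (E₂.symm (uη⁻¹ ^ (m)), 1)) * k) ∂ν)) :=
  fun t ht hmfl m hm => hj t (h00 t ht hmfl) (oT t) (hoT t ht hmfl).2 m hm

end Deep

end Literature.NumberTheory.Rogawski1990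

end
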